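import Summits.Ventures.CertifiedManyBodySolver.Observables.PhaseSeparationExclusionFourFifthsAnchorsAxis
import Literature.MathematicalPhysics.QuantumLattice.HubbardTTPrimePhaseCoexistenceExclusionPeriodic
import HarnessLib
import HarnessLib.Audit

/-!
# Ventures/CertifiedManyBodySolver — Observables/PhaseSeparationExclusionPeriodicPhasesFourFifthsAnchors.lean (PERIODIC-PHASES EDITION of the rectangle words of `PhaseSeparationExclusionFourFifthsAnchorsAxis`)

HONEST FRAMING: first certified bounds; not a superconductivity verdict. CLASS = DERIVED / CONTEXT: the landed translation-invariant rectangle sentences of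
`PhaseSeparationExclusionFourFifthsAnchorsAxis` (hubbard-box-p3 g30) pushed through the PROVED transfer law
`InfVolFermionState.IsPeriodic.energyDensityTT'_lt_cellEnergy_mix_of_forall_isTranslationInvariant_thresholds` (hubbard-box-p3 g24; thresholds `r₁ = n₁`, `r₂ = 4/5`):
the separated components may be ANY `q`-periodic states (stripes, Néel, density waves) with cell fillings `≤ n₁` / `≥ 7/8`. Same hypotheses as the parents; nothing
else asserted; no certificate, no CERTIFIED row, no MOVE. Seat hubbard-box-p3 g30; generator `pub/hubbard-fast/hubbard-box-p3/work-g30/se78/emit78.py`.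
WHAT THIS IS NOT: a certificate; a statement at `t′ > 0`, `T > 0`, or about superconductivity.
[cite: Israel1979, Thm. I.2.4] [cite: EmeryKivelsonLin1990, pp. 475–476] [cite: BratteliRobinsonI1987, §4.3.1]
-/

noncomputable section

namespace Summit.Ventures.CertifiedManyBodySolver.Observables

open Summit.Ventures.CertifiedManyBodySolver.Certificates Summit.Ventures.CertifiedManyBodySolver.Downfold
open Literature.MathematicalPhysics.QuantumLattice Literature.MathematicalPhysics.QuantumLattice.ThermodynamicLimit
open Literature.MathematicalPhysics.QuantumLattice.InfVolFermionState Set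

/-- **PERIODIC-PHASES edition of `fourFifths_not_groundState_mix_le_1o5_ge_4o5_PQR`** (`t = 1`, rectangle `[-3 / 10, 0] × [8, 77 / 5]`): for all `q`-periodic states `ω₁, ω₂` of `ℤ²`
(stripes, Néel / density-wave states, any superlattice order with a common period lattice `q`) with CELL FILLINGS `0 < ρ̄(ω₁) ≤ 1/5`, `4/5 ≤ ρ̄(ω₂) < 2` and every
`0 < λ < 1`, the phase-separated state `λω₁ + (1−λ)ω₂` has energy per site (`cellEnergy`) STRICTLY above `e(1, s, U, ·)` at its filling — not a ground state.
Hypotheses as in the parent. [cite: Israel1979, Thm. I.2.4] [cite: EmeryKivelsonLin1990, pp. 475–476] [cite: BratteliRobinsonI1987, §4.3.1] -/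
theorem fourFifths_not_groundState_mix_le_1o5_ge_4o5_PQR_periodic (h468 : cert_r468_openbox_32x4_N64_planes) (h589 : cert_r589_bs_GU8n4o5tpm3o10_w3_b4_R2_ob5p2_kry1_kry2c3rel_hanK7B4D4_KN4_PR20d4_hanK8c2s_uprime) (h548 : cert_r548_HYB_GU8n4o5eom8_w3_b4_R2_ob5p2_kry1_kry2c3rel_menu_core_twin_focert_it8000)
    {s : ℝ} (hs : s ∈ Icc (-3 / 10 : ℝ) 0) {U : ℝ} (hU : U ∈ Icc (8 : ℝ) (77 / 5 : ℝ))
    {q : Fin 2 → ℕ} {ω₁ ω₂ : InfVolFermionState 2} (h₁ : ω₁.IsPeriodic q) (h₂ : ω₂.IsPeriodic q)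
    (hρ₁ : 0 < ω₁.cellFilling q) (hρ₁' : ω₁.cellFilling q ≤ (1 / 5)) (hρ₂ : 4 / 5 ≤ ω₂.cellFilling q) (hρ₂' : ω₂.cellFilling q < 2)
    {lam : ℝ} (hl0 : 0 < lam) (hl1 : lam < 1) :
    energyDensityTT' 1 s U ((mix lam hl0.le hl1.le ω₁ ω₂).cellFilling q) <
      (mix lam hl0.le hl1.le ω₁ ω₂).cellEnergy (fun _ : Cell q => hubbardTTPrimeFermionInteraction 1 s U) 1 :=
  IsPeriodic.energyDensityTT'_lt_cellEnergy_mix_of_forall_isTranslationInvariant_thresholds 1 s U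
    (fun _ _ k₁ k₂ a b c e _ hl0' hl1' => fourFifths_not_groundState_mix_le_1o5_ge_4o5_PQR h468 h589 h548 hs hU k₁ k₂ a b c e hl0' hl1')
    h₁ h₂ hρ₁ hρ₁' hρ₂ hρ₂' hl0 hl1

/-- **PERIODIC-PHASES edition of `fourFifths_not_groundState_mix_le_1o4_ge_4o5_PQR`** (`t = 1`, rectangle `[-3 / 10, 0] × [8, 239 / 20]`): for all `q`-periodic states `ω₁, ω₂` of `ℤ²`
(stripes, Néel / density-wave states, any superlattice order with a common period lattice `q`) with CELL FILLINGS `0 < ρ̄(ω₁) ≤ 1/4`, `4/5 ≤ ρ̄(ω₂) < 2` and every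
`0 < λ < 1`, the phase-separated state `λω₁ + (1−λ)ω₂` has energy per site (`cellEnergy`) STRICTLY above `e(1, s, U, ·)` at its filling — not a ground state.
Hypotheses as in the parent. [cite: Israel1979, Thm. I.2.4] [cite: EmeryKivelsonLin1990, pp. 475–476] [cite: BratteliRobinsonI1987, §4.3.1] -/
theorem fourFifths_not_groundState_mix_le_1o4_ge_4o5_PQR_periodic (h468 : cert_r468_openbox_32x4_N64_planes) (h589 : cert_r589_bs_GU8n4o5tpm3o10_w3_b4_R2_ob5p2_kry1_kry2c3rel_hanK7B4D4_KN4_PR20d4_hanK8c2s_uprime) (h548 : cert_r548_HYB_GU8n4o5eom8_w3_b4_R2_ob5p2_kry1_kry2c3rel_menu_core_twin_focert_it8000)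
    {s : ℝ} (hs : s ∈ Icc (-3 / 10 : ℝ) 0) {U : ℝ} (hU : U ∈ Icc (8 : ℝ) (239 / 20 : ℝ))
    {q : Fin 2 → ℕ} {ω₁ ω₂ : InfVolFermionState 2} (h₁ : ω₁.IsPeriodic q) (h₂ : ω₂.IsPeriodic q)
    (hρ₁ : 0 < ω₁.cellFilling q) (hρ₁' : ω₁.cellFilling q ≤ (1 / 4)) (hρ₂ : 4 / 5 ≤ ω₂.cellFilling q) (hρ₂' : ω₂.cellFilling q < 2)
    {lam : ℝ} (hl0 : 0 < lam) (hl1 : lam < 1) :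
    energyDensityTT' 1 s U ((mix lam hl0.le hl1.le ω₁ ω₂).cellFilling q) <
      (mix lam hl0.le hl1.le ω₁ ω₂).cellEnergy (fun _ : Cell q => hubbardTTPrimeFermionInteraction 1 s U) 1 :=
  IsPeriodic.energyDensityTT'_lt_cellEnergy_mix_of_forall_isTranslationInvariant_thresholds 1 s U
    (fun _ _ k₁ k₂ a b c e _ hl0' hl1' => fourFifths_not_groundState_mix_le_1o4_ge_4o5_PQR h468 h589 h548 hs hU k₁ k₂ a b c e hl0' hl1')
    h₁ h₂ hρ₁ hρ₁' hρ₂ hρ₂' hl0 hl1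

/-- **PERIODIC-PHASES edition of `fourFifths_not_groundState_mix_le_3o10_ge_4o5_QR`** (`t = 1`, rectangle `[-1 / 4, 0] × [8, 42 / 5]`): for all `q`-periodic states `ω₁, ω₂` of `ℤ²`
(stripes, Néel / density-wave states, any superlattice order with a common period lattice `q`) with CELL FILLINGS `0 < ρ̄(ω₁) ≤ 3/10`, `4/5 ≤ ρ̄(ω₂) < 2` and every
`0 < λ < 1`, the phase-separated state `λω₁ + (1−λ)ω₂` has energy per site (`cellEnergy`) STRICTLY above `e(1, s, U, ·)` at its filling — not a ground state.
Hypotheses as in the parent. [cite: Israel1979, Thm. I.2.4] [cite: EmeryKivelsonLin1990, pp. 475–476] [cite: BratteliRobinsonI1987, §4.3.1] -/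
theorem fourFifths_not_groundState_mix_le_3o10_ge_4o5_QR_periodic (h468 : cert_r468_openbox_32x4_N64_planes) (h589 : cert_r589_bs_GU8n4o5tpm3o10_w3_b4_R2_ob5p2_kry1_kry2c3rel_hanK7B4D4_KN4_PR20d4_hanK8c2s_uprime) (h548 : cert_r548_HYB_GU8n4o5eom8_w3_b4_R2_ob5p2_kry1_kry2c3rel_menu_core_twin_focert_it8000)
    {s : ℝ} (hs : s ∈ Icc (-1 / 4 : ℝ) 0) {U : ℝ} (hU : U ∈ Icc (8 : ℝ) (42 / 5 : ℝ))
    {q : Fin 2 → ℕ} {ω₁ ω₂ : InfVolFermionState 2} (h₁ : ω₁.IsPeriodic q) (h₂ : ω₂.IsPeriodic q)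
    (hρ₁ : 0 < ω₁.cellFilling q) (hρ₁' : ω₁.cellFilling q ≤ (3 / 10)) (hρ₂ : 4 / 5 ≤ ω₂.cellFilling q) (hρ₂' : ω₂.cellFilling q < 2)
    {lam : ℝ} (hl0 : 0 < lam) (hl1 : lam < 1) :
    energyDensityTT' 1 s U ((mix lam hl0.le hl1.le ω₁ ω₂).cellFilling q) <
      (mix lam hl0.le hl1.le ω₁ ω₂).cellEnergy (fun _ : Cell q => hubbardTTPrimeFermionInteraction 1 s U) 1 :=
  IsPeriodic.energyDensityTT'_lt_cellEnergy_mix_of_forall_isTranslationInvariant_thresholds 1 s U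
    (fun _ _ k₁ k₂ a b c e _ hl0' hl1' => fourFifths_not_groundState_mix_le_3o10_ge_4o5_QR h468 h589 h548 hs hU k₁ k₂ a b c e hl0' hl1')
    h₁ h₂ hρ₁ hρ₁' hρ₂ hρ₂' hl0 hl1

end Summit.Ventures.CertifiedManyBodySolver.Observables

end
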